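import Literature.AnabelianGeometry.EtaleTheta.Discharge.Sec1ZHatEndomorphismLevels
import Literature.AnabelianGeometry.EtaleTheta.Discharge.Sec2FreeGenerators
import Literature.AnabelianGeometry.EtaleTheta.Discharge.Sec2ClassTwoCommutators
import HarnessLib

/-!
# [EtTh] §1 p. 13: "`(Δ^tp_Y)^ell ≅ Ẑ(1)`" — the pure-profinite core: for the free profinite group `Δ` on
# two generators and a continuous surjection `Δ ↠ Ẑ`, the kernel modulo `[Δ,Δ]⁻` IS `Ẑ` (proof-only)

Mochizuki, *The étale theta function and its Frobenioid-theoretic manifestations*, Publ. RIMS **45**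
(2009) [EtTh], §1, PRIMS PDF p. 12 ("`Δ_X` is a profinite free group on 2 generators … `Δ^ell_X := Δ^ab_X`")
and p. 13 ("`(Δ^tp_Y)^ell ≅ Ẑ(1)`") [cite: MochizukiEtTh2009, §1 p.13]. Layer L2 of the abc-iut cell, seat
abc-iut-w5-d024 (gen 3), L2-lead RULINGS #3 R30 (NV-L6 `CoreTower` input (ii), routed by L6-lead §F v1.19a
(3)); PROOF-ONLY, generic (no `ThetaSetting` here), no definition, nothing of another seat restated.
Consumed by `Discharge/Sec1DeltaYEllZHat.lean` (the tempered transport at the [EtTh] §1 theta setting).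

WHAT IS PROVED. `IsFreeProfiniteOnTwo.exists_hom_kerInf_commutatorClosure_zHat`: for a closed normal
subgroup `Δ ≤ E` (`E` compact Hausdorff) with `IsFreeProfiniteOnTwo Δ` and a continuous `φ : E → Ẑ` with
`η(1) ∈ φ(Δ)`, a surjection `ρ : Ker φ ∩ Δ ↠ Ẑ` with kernel `[Δ,Δ]⁻` — i.e. the abelianized image of
`Ker(φ|Δ)` is `Ẑ` ("`Ker(Ẑ² ↠ Ẑ) ≅ Ẑ`"). Method: the abelian twin of abc-iut-w5-d171's Heisenberg argument
(`Sec1FreeTwoHeisenbergZHat.lean`): decomposition `Δ = a^Ẑ b^Ẑ [Δ,Δ]⁻`, `(ℤ/n)²` test quotients, and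
`Ẑ`-linear algebra carried out levelwise through continuous endomorphisms of `Ẑ`
(`Sec1ZHatEndomorphismLevels.lean`) — the tree's `Ẑ` (Mathlib's profinite completion of `ℤ`) has no ring
structure, and none is needed. Classical profinite group theory [cite: RibesZalesskii2010, Thm 2.7.1].
HONEST FRAMING: [EtTh] is refereed; nothing here concerns or takes a side on [IUTchIII] Cor. 3.12.
-/

noncomputable section

namespace Literature.AnabelianGeometry.EtaleTheta

open Literature.AnabelianGeometry.AbsoluteAnabelian
open _root_.Topology
open scoped commutatorElement
open CategoryTheory ProfiniteGrp ProfiniteGrp.ProfiniteCompletion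

section Core

open ZHatLevels

variable {E : Type} [Group E] [TopologicalSpace E] [IsTopologicalGroup E] [CompactSpace E]
  [T2Space E]

/-- **`Ker(F̂₂ ↠ Ẑ)/[F̂₂,F̂₂]⁻ ≅ Ẑ`, quotient-free form** (the pure-profinite core of "`(Δ^tp_Y)^ell ≅ Ẑ(1)`",
[EtTh] p. 13). Let `Δ` be a closed normal subgroup of a compact Hausdorff topological group `E` which is a
free profinite group on two generators (`IsFreeProfiniteOnTwo`, p. 12 "`Δ_X` is a profinite free group on 2
generators"), and let `φ : E → Ẑ` be a continuous homomorphism taking the value `η(1)` on `Δ` (so `φ(Δ) = Ẑ`).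
Then there is a SURJECTIVE homomorphism `ρ : Ker φ ∩ Δ ↠ Ẑ` whose kernel is exactly `[Δ,Δ]⁻`:
as an abstract group, `(Ker φ ∩ Δ)/[Δ,Δ]⁻ ≅ Ẑ`.
PROOF. (1) DECOMPOSITION `Δ = a^Ẑ·b^Ẑ·K₂` (`K₂ = [Δ,Δ]⁻`; `a, b` free topological generators,
`Sec2FreeGenerators`; `a^Ẑ` = the continuous `Ẑ → Δ`, `η1 ↦ a`): the set `a^Ẑ b^Ẑ K₂` is compact and a subgroup
modulo the central-mod-`K₂` calculus, hence a closed subgroup containing the dense `⟨a,b⟩`. (2) `φ` kills `K₂`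
(`Ẑ` commutative, `Ker φ` closed); write `A = φ(a^·)`, `B = φ(b^·)` (continuous endomorphisms of `Ẑ`).
(3) UNIMODULARITY `A u · B v = η 1` from the hypothesis. (4) The exponents of `a^s b^t` are determined modulo
`K₂`: test against the finite quotients `(ℤ/n)²` (freeness; w5-d171's `apply_pow_eq_zpow`).
(5)–(7) The map `κ : Ẑ → (Ker φ ∩ Δ)/K₂`, `r ↦ [a^{B r} b^{A r⁻¹}]`, is a bijective homomorphism: all
verifications are congruences `mod n` at each level of `Ẑ` (`Sec1ZHatEndomorphismLevels`: continuous
endomorphisms act by multiplication levelwise and commute), using the unimodular relation — the kernel of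
the row `(α β)` is the line through `(β, −α)`. (8) `ρ :=` the inverse of `κ` composed with the projection.
[cite: MochizukiEtTh2009, §1 p.13] -/
theorem IsFreeProfiniteOnTwo.exists_hom_kerInf_commutatorClosure_zHat {Δ : Subgroup E} [hΔn : Δ.Normal]
    (hfree : IsFreeProfiniteOnTwo Δ) (hΔc : IsClosed (Δ : Set E))
    (φ : E →ₜ* completion (GrpCat.of (Multiplicative ℤ)))
    (h1 : ∃ x ∈ Δ, φ x = etaFn (GrpCat.of (Multiplicative ℤ)) (Multiplicative.ofAdd (1 : ℤ))) :
    ∃ ρ : ↥(φ.toMonoidHom.ker ⊓ Δ) →* completion (GrpCat.of (Multiplicative ℤ)),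
      Function.Surjective ρ ∧
      ∀ x, ρ x = 1 ↔ (x : E) ∈ (⁅Δ, Δ⁆).topologicalClosure := by
  classical
  let G : GrpCat.{0} := GrpCat.of (Multiplicative ℤ)
  let η1 : completion G := etaFn G (Multiplicative.ofAdd (1 : ℤ))
  haveI hK₂n : (⁅Δ, Δ⁆).topologicalClosure.Normal := Subgroup.is_normal_topologicalClosure _
  set K₂ : Subgroup E := (⁅Δ, Δ⁆).topologicalClosure with hK₂def
  have hK₂closed : IsClosed (K₂ : Set E) := Subgroup.isClosed_topologicalClosure _
  have hcommΔ : ⁅Δ, Δ⁆ ≤ Δ := Subgroup.commutator_le_left Δ Δ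
  have hK₂Δ : K₂ ≤ Δ := Subgroup.topologicalClosure_minimal _ hcommΔ hΔc
  -- the free pair, topologically generating `Δ`
  obtain ⟨a, b, huniv, hdense⟩ := hfree.exists_generators
  obtain ⟨hcpt, ht2, htd, -⟩ := hfree
  haveI : CompactSpace Δ := hcpt
  haveI : T2Space Δ := ht2
  haveI : TotallyDisconnectedSpace Δ := htd
  -- `Ẑ`-powers of `a` and `b`
  obtain ⟨pa, hpa⟩ := ZHatCompletion.exists_continuousMonoidHom_apply_eq (P := ↥Δ) a
  obtain ⟨pb, hpb⟩ := ZHatCompletion.exists_continuousMonoidHom_apply_eq (P := ↥Δ) b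
  have hpa' : pa η1 = a := hpa
  have hpb' : pb η1 = b := hpb
  -- the quotient modulo `K₂`; `Δ` is commutative modulo `K₂`
  let π : E →* E ⧸ K₂ := QuotientGroup.mk' K₂
  have hπK₂ : ∀ k ∈ K₂, π k = 1 := fun k hk => (QuotientGroup.eq_one_iff k).mpr hk
  have hπcomm : ∀ x ∈ Δ, ∀ y ∈ Δ, π x * π y = π y * π x := by
    intro x hx y hy
    have h : ⁅π x, π y⁆ = 1 := by
      rw [← map_commutatorElement]
      exact hπK₂ _ (Subgroup.le_topologicalClosure _ (Subgroup.commutator_mem_commutator hx hy))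
    exact (commutatorElement_eq_one_iff_commute.mp h).eq
  -- the products `a^s b^t` modulo `K₂` multiply coordinatewise
  have hprod : ∀ s t s' t', π (((pa s : Δ) : E) * ((pb t : Δ) : E)) *
      π (((pa s' : Δ) : E) * ((pb t' : Δ) : E)) =
      π (((pa (s * s') : Δ) : E) * ((pb (t * t') : Δ) : E)) := by
    intro s t s' t'
    rw [map_mul pa, map_mul pb, Subgroup.coe_mul, Subgroup.coe_mul]
    simp only [map_mul]
    rw [mul_assoc, mul_assoc, ← mul_assoc (π ((pb t : Δ) : E)),
      hπcomm _ (pb t).2 _ (pa s').2, mul_assoc]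
  have hinvprod : ∀ s t, (π (((pa s : Δ) : E) * ((pb t : Δ) : E)))⁻¹ =
      π (((pa s⁻¹ : Δ) : E) * ((pb t⁻¹ : Δ) : E)) := by
    intro s t
    rw [← map_inv, mul_inv_rev, map_inv pa, map_inv pb, Subgroup.coe_inv, Subgroup.coe_inv,
      map_mul, map_mul, hπcomm _ (Δ.inv_mem (pb t).2) _ (Δ.inv_mem (pa s).2)]
  -- ### (1) DECOMPOSITION `Δ = a^Ẑ · b^Ẑ · K₂`
  let S : Subgroup E :=
    { carrier := {x | ∃ s t, π x = π (((pa s : Δ) : E) * ((pb t : Δ) : E))}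
      one_mem' := ⟨1, 1, by rw [map_one pa, map_one pb, OneMemClass.coe_one, mul_one]⟩
      mul_mem' := by
        rintro x y ⟨s, t, hx⟩ ⟨s', t', hy⟩
        exact ⟨s * s', t * t', by rw [map_mul, hx, hy, hprod]⟩
      inv_mem' := by
        rintro x ⟨s, t, hx⟩
        exact ⟨s⁻¹, t⁻¹, by rw [map_inv, hx, hinvprod]⟩ }
  have hS_mem : ∀ x, x ∈ S ↔ ∃ s t, ∃ k ∈ K₂, x = ((pa s : Δ) : E) * ((pb t : Δ) : E) * k := by
    intro x
    constructor
    · rintro ⟨s, t, hx⟩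
      obtain ⟨z, hz, hxz⟩ := (QuotientGroup.mk'_eq_mk' K₂).mp hx
      refine ⟨s, t, z⁻¹, K₂.inv_mem hz, ?_⟩
      rw [← hxz, mul_inv_cancel_right]
    · rintro ⟨s, t, k, hk, rfl⟩
      refine ⟨s, t, ?_⟩
      rw [map_mul, hπK₂ k hk, mul_one]
  have hSclosed : IsClosed (S : Set E) := by
    have himage : (S : Set E) =
        (fun q : (completion G × completion G) × E =>
          ((pa q.1.1 : Δ) : E) * ((pb q.1.2 : Δ) : E) * q.2) ''
          ((Set.univ : Set (completion G × completion G)) ×ˢ (K₂ : Set E)) := by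
      ext x
      simp only [SetLike.mem_coe, hS_mem, Set.mem_image, Set.mem_prod, Set.mem_univ, true_and,
        Prod.exists]
      constructor
      · rintro ⟨s, t, k, hk, rfl⟩; exact ⟨s, t, k, hk, rfl⟩
      · rintro ⟨s, t, k, hk, rfl⟩; exact ⟨s, t, k, hk, rfl⟩
    rw [himage]
    refine (IsCompact.image (isCompact_univ.prod hK₂closed.isCompact) ?_).isClosed
    have h1 : Continuous fun q : (completion G × completion G) × E => ((pa q.1.1 : Δ) : E) :=
      continuous_subtype_val.comp (pa.continuous_toFun.comp (continuous_fst.comp continuous_fst))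
    have h2 : Continuous fun q : (completion G × completion G) × E => ((pb q.1.2 : Δ) : E) :=
      continuous_subtype_val.comp (pb.continuous_toFun.comp (continuous_snd.comp continuous_fst))
    exact (h1.mul h2).mul continuous_snd
  have hΔS : ∀ x ∈ Δ, x ∈ S := by
    let T : Subgroup Δ := S.comap Δ.subtype
    have hTclosed : IsClosed (T : Set Δ) := hSclosed.preimage continuous_subtype_val
    have haT : a ∈ T := by
      refine ⟨η1, 1, ?_⟩
      rw [map_one, OneMemClass.coe_one, mul_one, hpa', Subgroup.coe_subtype]
    have hbT : b ∈ T := by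
      refine ⟨1, η1, ?_⟩
      rw [map_one, OneMemClass.coe_one, one_mul, hpb', Subgroup.coe_subtype]
    have hcl : Subgroup.closure ({a, b} : Set Δ) ≤ T := by
      rw [Subgroup.closure_le]
      rintro x (rfl | rfl)
      · exact haT
      · exact hbT
    have htop : (Subgroup.closure ({a, b} : Set Δ)).topologicalClosure ≤ T :=
      Subgroup.topologicalClosure_minimal _ hcl hTclosed
    rw [hdense] at htop
    intro x hx
    have : (⟨x, hx⟩ : Δ) ∈ T := htop (Subgroup.mem_top _)
    exact this
  have hdecomp : ∀ x ∈ Δ, ∃ s t, ∃ k ∈ K₂, x = ((pa s : Δ) : E) * ((pb t : Δ) : E) * k :=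
    fun x hx => (hS_mem x).mp (hΔS x hx)
  -- ### (2) `φ` kills `K₂`; the coordinates `A = φ(a^·)`, `B = φ(b^·)`
  have hφK₂ : ∀ k ∈ K₂, φ k = 1 := by
    have hker_closed : IsClosed ((φ.toMonoidHom.ker : Subgroup E) : Set E) :=
      isClosed_singleton.preimage φ.continuous_toFun
    have hle : ⁅Δ, Δ⁆ ≤ φ.toMonoidHom.ker := by
      rw [Subgroup.commutator_le]
      intro x _ y _
      rw [MonoidHom.mem_ker, ContinuousMonoidHom.coe_toMonoidHom, map_commutatorElement,
        commutatorElement_eq_one_iff_commute]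
      exact mul_comm_of_dense_zpowers ZHatCompletion.dense_zpowers_eta_one _ _
    intro k hk
    exact Subgroup.topologicalClosure_minimal _ hle hker_closed hk
  let ιΔ : Δ →ₜ* E := ContinuousMonoidHom.mk Δ.subtype continuous_subtype_val
  let A : completion G →ₜ* completion G := (φ.comp ιΔ).comp pa
  let B : completion G →ₜ* completion G := (φ.comp ιΔ).comp pb
  have hA : ∀ s, A s = φ ((pa s : Δ) : E) := fun _ => rfl
  have hB : ∀ t, B t = φ ((pb t : Δ) : E) := fun _ => rfl
  have hφprod : ∀ s t (k : E), k ∈ K₂ →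
      φ (((pa s : Δ) : E) * ((pb t : Δ) : E) * k) = A s * B t := by
    intro s t k hk
    rw [map_mul, map_mul, hφK₂ k hk, mul_one, hA, hB]
  -- ### (3) UNIMODULARITY: `A u · B v = η 1`
  obtain ⟨x₀, hx₀Δ, hx₀⟩ := h1
  obtain ⟨u, v, k₀, hk₀, hx₀eq⟩ := hdecomp x₀ hx₀Δ
  have hUV : A u * B v = η1 := by rw [← hφprod u v k₀ hk₀, ← hx₀eq, hx₀]
  -- ### (4) FINITE TEST QUOTIENTS `(ℤ/n)²`: the exponents in `a^s b^t` are determined modulo `K₂`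
  have htest : ∀ s t : completion G,
      ((pa s : Δ) : E) * ((pb t : Δ) : E) ∈ K₂ → s = 1 ∧ t = 1 := by
    intro s t hst
    suffices h : ∀ (N : FiniteIndexNormalSubgroup (Multiplicative ℤ))
        (w : completion G →ₜ* (Multiplicative ℤ ⧸ N.toSubgroup)), (∀ r, w r = r.val N) →
        w s = w 1 ∧ w t = w 1 from
      ⟨eq_of_forall_valHom fun N w hw => (h N w hw).1, eq_of_forall_valHom fun N w hw => (h N w hw).2⟩
    intro N w hw
    obtain ⟨n, hn, hN⟩ := exists_eq_zpowers N.toSubgroup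
    haveI : NeZero n := ⟨hn.ne'⟩
    letI : TopologicalSpace (Multiplicative (ZMod n) × Multiplicative (ZMod n)) := ⊥
    haveI : DiscreteTopology (Multiplicative (ZMod n) × Multiplicative (ZMod n)) := ⟨rfl⟩
    set z : Multiplicative (ZMod n) := Multiplicative.ofAdd 1 with hzdef
    have hzn : z ^ n = 1 := by
      rw [hzdef, ← ofAdd_nsmul, nsmul_eq_mul, mul_one, ZMod.natCast_self, ofAdd_zero]
    have hzord : orderOf z = n := by rw [hzdef, orderOf_ofAdd_eq_addOrderOf, ZMod.addOrderOf_one]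
    obtain ⟨F, ⟨hFa, hFb⟩, -⟩ := huniv (Multiplicative (ZMod n) × Multiplicative (ZMod n)) (z, 1) (1, z)
    -- `F` kills `K₂ ∩ Δ` (commutative target, closed kernel)
    have hFK₂ : ∀ d : Δ, (d : E) ∈ K₂ → F d = 1 := by
      have hle : K₂ ≤ (((⊥ : Subgroup (Multiplicative (ZMod n) × Multiplicative (ZMod n))).comap
          F.toMonoidHom).map Δ.subtype) := by
        refine Subgroup.topologicalClosure_minimal _ (Subgroup.commutator_le.mpr ?_)
          (ClassTwo.isClosed_map_subtype_comap hΔc F.toMonoidHom F.continuous_toFun _)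
        intro x hx y hy
        refine ⟨⁅(⟨x, hx⟩ : Δ), ⟨y, hy⟩⁆, ?_, rfl⟩
        rw [SetLike.mem_coe, Subgroup.mem_comap, map_commutatorElement, Subgroup.mem_bot,
          commutatorElement_eq_one_iff_commute]
        exact Commute.all _ _
      intro d hd
      exact Subgroup.mem_bot.mp (ClassTwo.mem_of_coe_mem_map_subtype_comap F.toMonoidHom _ (hle hd))
    obtain ⟨js, hjs⟩ := exists_valHom_eq_mk w hw s
    obtain ⟨jt, hjt⟩ := exists_valHom_eq_mk w hw t
    have hz1n : ((z, 1) : Multiplicative (ZMod n) × Multiplicative (ZMod n)) ^ n = 1 := by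
      rw [Prod.pow_mk, hzn, one_pow, Prod.mk_one_one]
    have h1zn : ((1, z) : Multiplicative (ZMod n) × Multiplicative (ZMod n)) ^ n = 1 := by
      rw [Prod.pow_mk, hzn, one_pow, Prod.mk_one_one]
    have hFpa : ∀ m : ℤ, F (pa (etaFn (GrpCat.of (Multiplicative ℤ))
        (Multiplicative.ofAdd m : Multiplicative ℤ))) =
        ((z, 1) : Multiplicative (ZMod n) × Multiplicative (ZMod n)) ^ m := by
      intro m
      rw [ZHatCompletion.etaFn_ofAdd m, map_zpow, map_zpow]
      exact congrArg (· ^ m) ((congrArg F hpa).trans hFa)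
    have hFpb : ∀ m : ℤ, F (pb (etaFn (GrpCat.of (Multiplicative ℤ))
        (Multiplicative.ofAdd m : Multiplicative ℤ))) =
        ((1, z) : Multiplicative (ZMod n) × Multiplicative (ZMod n)) ^ m := by
      intro m
      rw [ZHatCompletion.etaFn_ofAdd m, map_zpow, map_zpow]
      exact congrArg (· ^ m) ((congrArg F hpb).trans hFb)
    have h1 := apply_pow_eq_zpow pa F _ hz1n N hN hFpa s ((hw s).symm.trans hjs)
    have h2 := apply_pow_eq_zpow pb F _ h1zn N hN hFpb t ((hw t).symm.trans hjt)
    have hone : F (pa s * pb t) = 1 := hFK₂ _ (by rw [Subgroup.coe_mul]; exact hst)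
    rw [map_mul, h1, h2, Prod.ext_iff] at hone
    obtain ⟨hone1, hone2⟩ := hone
    simp only [Prod.fst_mul, Prod.snd_mul, Prod.pow_fst, Prod.pow_snd, one_zpow, mul_one, one_mul,
      Prod.fst_one, Prod.snd_one] at hone1 hone2
    have hs1 := val_eq_one_of_zpow_eq_one z hzord N hN s ((hw s).symm.trans hjs) hone1
    have ht1 := val_eq_one_of_zpow_eq_one z hzord N hN t ((hw t).symm.trans hjt) hone2
    exact ⟨(hw s).trans (hs1.trans (map_one w).symm), (hw t).trans (ht1.trans (map_one w).symm)⟩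
  -- ### (5) LEVELWISE DATA: exponents of `A`, `B`, `u`, `v` and the unimodular relation
  have hlevel : ∀ (N : FiniteIndexNormalSubgroup (Multiplicative ℤ))
      (w : completion G →ₜ* (Multiplicative ℤ ⧸ N.toSubgroup)), (∀ r, w r = r.val N) →
      ∃ n : ℕ, 0 < n ∧
      ∃ hN : (N.toSubgroup : Subgroup (Multiplicative ℤ)) =
          Subgroup.zpowers (Multiplicative.ofAdd (n : ℤ)),
      ∃ i k ju jv : ℤ,
        w (A η1) = QuotientGroup.mk (Multiplicative.ofAdd i) ∧
        w (B η1) = QuotientGroup.mk (Multiplicative.ofAdd k) ∧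
        w u = QuotientGroup.mk (Multiplicative.ofAdd ju) ∧
        w v = QuotientGroup.mk (Multiplicative.ofAdd jv) ∧
        (ju : ZMod n) * (i : ZMod n) + (jv : ZMod n) * (k : ZMod n) = 1 := by
    intro N w hw
    obtain ⟨n, hn, hN⟩ := exists_eq_zpowers N.toSubgroup
    obtain ⟨i, hi⟩ := exists_valHom_eq_mk w hw (A η1)
    obtain ⟨k, hk⟩ := exists_valHom_eq_mk w hw (B η1)
    obtain ⟨ju, hju⟩ := exists_valHom_eq_mk w hw u
    obtain ⟨jv, hjv⟩ := exists_valHom_eq_mk w hw v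
    refine ⟨n, hn, hN, i, k, ju, jv, hi, hk, hju, hjv, ?_⟩
    have h := congrArg w hUV
    rw [map_mul, valHom_apply_of_continuous A hN w hw hi u hju,
      valHom_apply_of_continuous B hN w hw hk v hjv, mk_ofAdd_mul_mk_ofAdd,
      valHom_etaFn_one w hw, mk_ofAdd_eq_mk_ofAdd_iff hN] at h
    push_cast at h
    exact h
  -- ### (6) MULTIPLICATION BY `u` AND `v` ON `Ẑ`
  obtain ⟨U, hU⟩ := ZHatCompletion.exists_continuousMonoidHom_apply_eq (P := completion G) u
  obtain ⟨V, hV⟩ := ZHatCompletion.exists_continuousMonoidHom_apply_eq (P := completion G) v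
  have hU' : U η1 = u := hU
  have hV' : V η1 = v := hV
  -- ### (7) THE MAP `κ : Ẑ → (Ker φ ∩ Δ)/K₂`, `r ↦ [a^{βr} b^{-αr}]`
  haveI hK₂n' : (K₂.subgroupOf (φ.toMonoidHom.ker ⊓ Δ)).Normal := inferInstance
  have hxmem : ∀ r : completion G,
      ((pa (B r) : Δ) : E) * ((pb (A r⁻¹) : Δ) : E) ∈ φ.toMonoidHom.ker ⊓ Δ := by
    intro r
    refine Subgroup.mem_inf.mpr ⟨?_, Δ.mul_mem (pa _).2 (pb _).2⟩
    rw [MonoidHom.mem_ker]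
    change φ (((pa (B r) : Δ) : E) * ((pb (A r⁻¹) : Δ) : E)) = 1
    have h := hφprod (B r) (A r⁻¹) 1 K₂.one_mem
    rw [mul_one] at h
    rw [h, apply_comm_of_continuous A B r, map_inv, map_inv, mul_inv_cancel]
  let xr : completion G → ↥(φ.toMonoidHom.ker ⊓ Δ) := fun r => ⟨_, hxmem r⟩
  have hxr : ∀ r, ((xr r : ↥(φ.toMonoidHom.ker ⊓ Δ)) : E) =
      ((pa (B r) : Δ) : E) * ((pb (A r⁻¹) : Δ) : E) := fun _ => rfl
  have hQeq : ∀ x y : ↥(φ.toMonoidHom.ker ⊓ Δ),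
      (QuotientGroup.mk x : ↥(φ.toMonoidHom.ker ⊓ Δ) ⧸ K₂.subgroupOf (φ.toMonoidHom.ker ⊓ Δ)) =
        QuotientGroup.mk y ↔ π (x : E) = π (y : E) := by
    intro x y
    rw [QuotientGroup.eq, Subgroup.mem_subgroupOf, Subgroup.coe_mul, Subgroup.coe_inv]
    change _ ↔ (QuotientGroup.mk (x : E) : E ⧸ K₂) = QuotientGroup.mk (y : E)
    rw [QuotientGroup.eq]
  let κ : completion G →* ↥(φ.toMonoidHom.ker ⊓ Δ) ⧸ K₂.subgroupOf (φ.toMonoidHom.ker ⊓ Δ) :=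
    { toFun := fun r => QuotientGroup.mk (xr r)
      map_one' := by
        change (QuotientGroup.mk (xr 1) : _ ⧸ _) = QuotientGroup.mk 1
        rw [hQeq, hxr, inv_one, map_one B, map_one A, map_one pa, map_one pb, OneMemClass.coe_one,
          mul_one, OneMemClass.coe_one]
      map_mul' := by
        intro r r'
        rw [← QuotientGroup.mk_mul, hQeq, Subgroup.coe_mul, hxr, hxr, hxr,
          map_mul π (((pa (B r) : Δ) : E) * ((pb (A r⁻¹) : Δ) : E)), hprod, map_mul B, mul_inv_rev,
          mul_comm_of_dense_zpowers ZHatCompletion.dense_zpowers_eta_one r'⁻¹ r⁻¹, map_mul A] }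
  have hκ_apply : ∀ r, κ r = QuotientGroup.mk (xr r) := fun r => rfl
  -- `κ` is injective
  have hκ_inj : Function.Injective κ := by
    rw [injective_iff_map_eq_one]
    intro r hr
    have hmem : ((pa (B r) : Δ) : E) * ((pb (A r⁻¹) : Δ) : E) ∈ K₂ := by
      rw [hκ_apply, QuotientGroup.eq_one_iff, Subgroup.mem_subgroupOf, hxr] at hr
      exact hr
    obtain ⟨hBr, hAr⟩ := htest _ _ hmem
    refine eq_of_forall_valHom fun N w hw => ?_
    obtain ⟨n, hn, hN, i, k, ju, jv, hi, hk, hju, hjv, huv⟩ := hlevel N w hw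
    haveI : NeZero n := ⟨hn.ne'⟩
    obtain ⟨j, hj⟩ := exists_valHom_eq_mk w hw r
    have hjinv : w r⁻¹ = QuotientGroup.mk (Multiplicative.ofAdd (-j)) := by
      rw [map_inv, hj, mk_ofAdd_inv]
    have e1 := valHom_apply_of_continuous B hN w hw hk r hj
    rw [hBr, map_one, ← mk_ofAdd_zero, mk_ofAdd_eq_mk_ofAdd_iff hN] at e1
    have e2 := valHom_apply_of_continuous A hN w hw hi r⁻¹ hjinv
    rw [hAr, map_one, ← mk_ofAdd_zero, mk_ofAdd_eq_mk_ofAdd_iff hN] at e2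
    push_cast at e1 e2
    rw [hj, map_one, ← mk_ofAdd_zero, mk_ofAdd_eq_mk_ofAdd_iff hN]
    push_cast
    linear_combination (-j) * huv + (-jv) * e1 + ju * e2
  -- `κ` is surjective
  have hκ_surj : Function.Surjective κ := by
    intro q
    obtain ⟨x, rfl⟩ := QuotientGroup.mk_surjective q
    obtain ⟨s, t, k', hk', hxeq⟩ := hdecomp (x : E) x.2.2
    have hφx : φ (x : E) = 1 := x.2.1
    have hst : A s * B t = 1 := by rw [← hφprod s t k' hk', ← hxeq, hφx]
    set r : completion G := V s * (U t)⁻¹ with hrdef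
    have hBr : B r = s := by
      refine eq_of_forall_valHom fun N w hw => ?_
      obtain ⟨n, hn, hN, i, k, ju, jv, hi, hk, hju, hjv, huv⟩ := hlevel N w hw
      haveI : NeZero n := ⟨hn.ne'⟩
      obtain ⟨js, hjs⟩ := exists_valHom_eq_mk w hw s
      obtain ⟨jt, hjt⟩ := exists_valHom_eq_mk w hw t
      have e := congrArg w hst
      rw [map_mul, valHom_apply_of_continuous A hN w hw hi s hjs,
        valHom_apply_of_continuous B hN w hw hk t hjt, mk_ofAdd_mul_mk_ofAdd, map_one,
        ← mk_ofAdd_zero, mk_ofAdd_eq_mk_ofAdd_iff hN] at e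
      push_cast at e
      have hVη : w (V η1) = QuotientGroup.mk (Multiplicative.ofAdd jv) := by rw [hV']; exact hjv
      have hUη : w (U η1) = QuotientGroup.mk (Multiplicative.ofAdd ju) := by rw [hU']; exact hju
      have hrN : w r = QuotientGroup.mk (Multiplicative.ofAdd (js * jv + -(jt * ju))) := by
        rw [hrdef, map_mul, map_inv, valHom_apply_of_continuous V hN w hw hVη s hjs,
          valHom_apply_of_continuous U hN w hw hUη t hjt, mk_ofAdd_inv, mk_ofAdd_mul_mk_ofAdd]
      rw [valHom_apply_of_continuous B hN w hw hk r hrN, hjs, mk_ofAdd_eq_mk_ofAdd_iff hN]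
      push_cast
      linear_combination js * huv - ju * e
    have hAr : A r⁻¹ = t := by
      refine eq_of_forall_valHom fun N w hw => ?_
      obtain ⟨n, hn, hN, i, k, ju, jv, hi, hk, hju, hjv, huv⟩ := hlevel N w hw
      haveI : NeZero n := ⟨hn.ne'⟩
      obtain ⟨js, hjs⟩ := exists_valHom_eq_mk w hw s
      obtain ⟨jt, hjt⟩ := exists_valHom_eq_mk w hw t
      have e := congrArg w hst
      rw [map_mul, valHom_apply_of_continuous A hN w hw hi s hjs,
        valHom_apply_of_continuous B hN w hw hk t hjt, mk_ofAdd_mul_mk_ofAdd, map_one,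
        ← mk_ofAdd_zero, mk_ofAdd_eq_mk_ofAdd_iff hN] at e
      push_cast at e
      have hVη : w (V η1) = QuotientGroup.mk (Multiplicative.ofAdd jv) := by rw [hV']; exact hjv
      have hUη : w (U η1) = QuotientGroup.mk (Multiplicative.ofAdd ju) := by rw [hU']; exact hju
      have hrN : w r⁻¹ = QuotientGroup.mk (Multiplicative.ofAdd (-(js * jv + -(jt * ju)))) := by
        rw [map_inv, hrdef, map_mul, map_inv, valHom_apply_of_continuous V hN w hw hVη s hjs,
          valHom_apply_of_continuous U hN w hw hUη t hjt, mk_ofAdd_inv, mk_ofAdd_mul_mk_ofAdd,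
          mk_ofAdd_inv]
      rw [valHom_apply_of_continuous A hN w hw hi r⁻¹ hrN, hjt, mk_ofAdd_eq_mk_ofAdd_iff hN]
      push_cast
      linear_combination jt * huv - jv * e
    refine ⟨r, ?_⟩
    rw [hκ_apply, hQeq, hxr, hBr, hAr, hxeq, map_mul π _ k', hπK₂ k' hk', mul_one]
  -- ### (8) ASSEMBLY
  let e : (↥(φ.toMonoidHom.ker ⊓ Δ) ⧸ K₂.subgroupOf (φ.toMonoidHom.ker ⊓ Δ)) ≃* completion G :=
    (MulEquiv.ofBijective κ ⟨hκ_inj, hκ_surj⟩).symm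
  refine ⟨e.toMonoidHom.comp (QuotientGroup.mk' (K₂.subgroupOf (φ.toMonoidHom.ker ⊓ Δ))),
    e.surjective.comp (QuotientGroup.mk'_surjective _), fun x => ?_⟩
  rw [MonoidHom.comp_apply, MulEquiv.coe_toMonoidHom, e.map_eq_one_iff, QuotientGroup.mk'_apply,
    QuotientGroup.eq_one_iff, Subgroup.mem_subgroupOf]

end Core

end Literature.AnabelianGeometry.EtaleTheta

end
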